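import Literature.NumberTheory.EllipticCurves.WeierstrassTorsion
import Literature.NumberTheory.EllipticCurves.WeierstrassSigmaProofs
import Mathlib.Analysis.Complex.CauchyIntegral

/-!
# Crux `RealOnePeriodRelations` (stmt-KontsevichZagierPeriods-10042), line `nash-retraction-thin-strip`, reshape 10:
# the `σ`-quotient `g_v(z) = (σ(z − v)/σ(z))^N · e^{η z}` (towards the lead's stub `stub_torsUnit`)

For a period pair `L` (lattice `Λ`, `σ = L.weierstrassSigma`, `ζ = L.weierstrassZeta`), a point `v ∉ Λ`, an exponent `N` and a
constant `η`, the meromorphic function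

  `sigmaQuot L v N η z = (σ(z − v) / σ(z)) ^ N * exp (η z)`

is, for TORSION `v` (`N v = m ω₁ + n ω₂`) and `η = m η₁ + n η₂`, the classical elliptic function with divisor `N(v) − N(0)`
(Whittaker–Watson §20.53: "any elliptic function can be expressed as a product of σ-functions times an exponential").  This file
proves what the torsion layer needs about it, from the tree's `σ`-facts (`WeierstrassSigmaProofs`: `σ` entire, zeros exactly `Λ`,
`σ′/σ = ζ`, quasi-periodicity) and Legendre's relation:

* `sigmaQuot_add_ω₁`, `sigmaQuot_add_ω₂` — `Λ`-periodicity for torsion `v` (the multipliers `e^{η ωᵢ − N ηᵢ v}` are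
  `e^{±2πi k} = 1` by Legendre `η₁ω₂ − η₂ω₁ = ±2πi`);
* `sigmaQuot_ne_zero` — no zeros off `Λ ∪ (v + Λ)`;
* `sigmaQuot_eq_div_pow_near_zero` — `g = F₁(z)/z^N` near `0` with `F₁` analytic, `F₁(0) ≠ 0` (pole of order exactly `N`);
* `sigmaQuot_eq_pow_mul` — `g = (z − v)^N · u(z)` with `u` analytic at `v`, `u(v) ≠ 0` (zero of order exactly `N`);
* `hasDerivAt_sigmaQuot` — `g′ = g · (N (ζ(z − v) − ζ(z)) + η)` off `Λ ∪ (v + Λ)`.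

[cite: WhittakerWatson1927, §20.42, §20.421, §20.53] [cite: SilvermanAEC2009, VI.3]
-/

noncomputable section

open scoped BigOperators Topology PeriodPair
open Set Filter Complex

namespace Summit.KontsevichZagierPeriods.SymplecticScissors.RealOnePeriodRelations

namespace TorsionLayer

variable (L : PeriodPair)

/-- **The `σ`-quotient** `g(z) = (σ(z − v)/σ(z))^N · e^{η z}`. [cite: WhittakerWatson1927, §20.53] -/
def sigmaQuot (v : ℂ) (N : ℕ) (η : ℂ) (z : ℂ) : ℂ :=
  (L.weierstrassSigma (z - v) / L.weierstrassSigma z) ^ N * cexp (η * z)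

/-- The entire factor `s(z) = ∏' (1 − z/l) e^{z/l + z²/(2l²)}` with `σ(z) = z · s(z)`. [cite: WhittakerWatson1927, §20.42] -/
def sigmaCofactor (z : ℂ) : ℂ := ∏' l : L.lattice, PeriodPair.sigmaFactor z l

/-- `σ(z) = z · s(z)`. [cite: WhittakerWatson1927, §20.42] -/
theorem weierstrassSigma_eq_mul_sigmaCofactor (z : ℂ) : L.weierstrassSigma z = z * sigmaCofactor L z := rfl

/-- `s` is entire. [cite: WhittakerWatson1927, §20.42] -/
theorem differentiable_sigmaCofactor : Differentiable ℂ (sigmaCofactor L) :=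
  L.differentiable_tprod_sigmaFactor

/-- `s(0) = 1`. [folklore] -/
theorem sigmaCofactor_zero : sigmaCofactor L 0 = 1 := L.tprod_sigmaFactor_zero

/-- `s(z) ≠ 0` off `Λ`. [folklore] -/
theorem sigmaCofactor_ne_zero {z : ℂ} (hz : z ∉ L.lattice) : sigmaCofactor L z ≠ 0 :=
  L.tprod_sigmaFactor_ne_zero hz

/-- `s` is analytic everywhere. [folklore] -/
theorem analyticAt_sigmaCofactor (z : ℂ) : AnalyticAt ℂ (sigmaCofactor L) z :=
  (differentiable_sigmaCofactor L).analyticAt z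

/-- `σ` is analytic everywhere. [cite: WhittakerWatson1927, §20.42] -/
theorem analyticAt_weierstrassSigma (z : ℂ) : AnalyticAt ℂ L.weierstrassSigma z :=
  L.differentiable_weierstrassSigma_holds.analyticAt z

/-! ### Zeros -/

/-- `g(z) ≠ 0` for `z ∉ Λ` with `z − v ∉ Λ`. [cite: WhittakerWatson1927, §20.42] -/
theorem sigmaQuot_ne_zero : ∀ (L : PeriodPair) (v : ℂ) (N : ℕ) (η : ℂ) {z : ℂ}, z ∉ L.lattice → z - v ∉ L.lattice → sigmaQuot L v N η z ≠ 0 := by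
  intro L v N η z hz hzv
  have h1 : L.weierstrassSigma (z - v) ≠ 0 := L.weierstrassSigma_ne_zero hzv
  have h2 : L.weierstrassSigma z ≠ 0 := L.weierstrassSigma_ne_zero hz
  unfold sigmaQuot
  exact mul_ne_zero (pow_ne_zero _ (div_ne_zero h1 h2)) (exp_ne_zero _)

/-! ### Periodicity for torsion `v` -/

/-- The quotient `σ(z − v)/σ(z)` picks up the factor `e^{−η₁ v}` under `z ↦ z + ω₁`. [cite: WhittakerWatson1927, §20.421] -/
theorem sigma_div_add_ω₁ (v z : ℂ) :
    L.weierstrassSigma (z + L.ω₁ - v) / L.weierstrassSigma (z + L.ω₁) =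
      cexp (-(L.η₁ * v)) * (L.weierstrassSigma (z - v) / L.weierstrassSigma z) := by
  have h1 : L.weierstrassSigma (z + L.ω₁ - v) = -cexp (L.η₁ * (z - v + L.ω₁ / 2)) * L.weierstrassSigma (z - v) := by
    rw [show z + L.ω₁ - v = (z - v) + L.ω₁ by ring]
    exact L.weierstrassSigma_add_ω₁_holds (z - v)
  have h2 : L.weierstrassSigma (z + L.ω₁) = -cexp (L.η₁ * (z + L.ω₁ / 2)) * L.weierstrassSigma z :=
    L.weierstrassSigma_add_ω₁_holds z
  rw [h1, h2]
  by_cases hσ : L.weierstrassSigma z = 0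
  · rw [hσ]; simp
  · have he : cexp (L.η₁ * (z + L.ω₁ / 2)) ≠ 0 := exp_ne_zero _
    have hexp : cexp (L.η₁ * (z - v + L.ω₁ / 2)) = cexp (-(L.η₁ * v)) * cexp (L.η₁ * (z + L.ω₁ / 2)) := by
      rw [← exp_add]; congr 1; ring
    rw [hexp]
    field_simp

/-- The quotient `σ(z − v)/σ(z)` picks up the factor `e^{−η₂ v}` under `z ↦ z + ω₂`. [cite: WhittakerWatson1927, §20.421] -/
theorem sigma_div_add_ω₂ (v z : ℂ) :
    L.weierstrassSigma (z + L.ω₂ - v) / L.weierstrassSigma (z + L.ω₂) =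
      cexp (-(L.η₂ * v)) * (L.weierstrassSigma (z - v) / L.weierstrassSigma z) := by
  have h1 : L.weierstrassSigma (z + L.ω₂ - v) = -cexp (L.η₂ * (z - v + L.ω₂ / 2)) * L.weierstrassSigma (z - v) := by
    rw [show z + L.ω₂ - v = (z - v) + L.ω₂ by ring]
    exact L.weierstrassSigma_add_ω₂_holds (z - v)
  have h2 : L.weierstrassSigma (z + L.ω₂) = -cexp (L.η₂ * (z + L.ω₂ / 2)) * L.weierstrassSigma z :=
    L.weierstrassSigma_add_ω₂_holds z
  rw [h1, h2]
  by_cases hσ : L.weierstrassSigma z = 0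
  · rw [hσ]; simp
  · have hexp : cexp (L.η₂ * (z - v + L.ω₂ / 2)) = cexp (-(L.η₂ * v)) * cexp (L.η₂ * (z + L.ω₂ / 2)) := by
      rw [← exp_add]; congr 1; ring
    rw [hexp]
    field_simp

/-- **Legendre multipliers are trivial**: for `N v = m ω₁ + n ω₂` and `η = m η₁ + n η₂`,
`e^{η ω₁ − N η₁ v} = 1` and `e^{η ω₂ − N η₂ v} = 1` (Legendre `η₁ω₂ − η₂ω₁ = ±2πi`). [cite: WhittakerWatson1927, §20.411] -/
theorem exp_legendre_multiplier {v η : ℂ} {N : ℕ} {m n : ℤ} (hNv : (N : ℂ) * v = m * L.ω₁ + n * L.ω₂)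
    (hη : η = m * L.η₁ + n * L.η₂) :
    cexp (η * L.ω₁ - N * (L.η₁ * v)) = 1 ∧ cexp (η * L.ω₂ - N * (L.η₂ * v)) = 1 := by
  have hNv' : (N : ℂ) * (L.η₁ * v) = L.η₁ * (m * L.ω₁ + n * L.ω₂) := by rw [← hNv]; ring
  have hNv'' : (N : ℂ) * (L.η₂ * v) = L.η₂ * (m * L.ω₁ + n * L.ω₂) := by rw [← hNv]; ring
  have key : ∀ (k : ℤ) (w : ℂ), (w = 2 * Real.pi * I ∨ -w = 2 * Real.pi * I) → cexp (k * w) = 1 := by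
    intro k w hw
    rcases hw with hw | hw
    · rw [hw]; exact exp_int_mul_two_pi_mul_I k
    · have : (k : ℂ) * w = (-k : ℤ) * (2 * Real.pi * I) := by rw [← hw]; push_cast; ring
      rw [this]; exact exp_int_mul_two_pi_mul_I (-k)
  have hleg := L.legendre_relation_up_to_sign
  constructor
  · have e : η * L.ω₁ - N * (L.η₁ * v) = n * (L.η₂ * L.ω₁ - L.η₁ * L.ω₂) := by rw [hNv', hη]; ring
    rw [e]
    refine key n _ (hleg.symm.imp id fun h => ?_)
    rw [← h]; ring
  · have e : η * L.ω₂ - N * (L.η₂ * v) = m * (L.η₁ * L.ω₂ - L.η₂ * L.ω₁) := by rw [hNv'', hη]; ring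
    rw [e]
    refine key m _ (hleg.imp id fun h => ?_)
    rw [← h]; ring

/-- **`Λ`-periodicity of the `σ`-quotient in `ω₁`** for torsion `v`. [cite: WhittakerWatson1927, §20.53] -/
theorem sigmaQuot_add_ω₁ {v η : ℂ} {N : ℕ} {m n : ℤ} (hNv : (N : ℂ) * v = m * L.ω₁ + n * L.ω₂)
    (hη : η = m * L.η₁ + n * L.η₂) (z : ℂ) : sigmaQuot L v N η (z + L.ω₁) = sigmaQuot L v N η z := by
  unfold sigmaQuot
  rw [sigma_div_add_ω₁, mul_pow, ← exp_nat_mul, mul_add, exp_add]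
  have h1 := (exp_legendre_multiplier L hNv hη).1
  calc cexp (N * -(L.η₁ * v)) * (L.weierstrassSigma (z - v) / L.weierstrassSigma z) ^ N * (cexp (η * z) * cexp (η * L.ω₁))
      = (cexp (N * -(L.η₁ * v)) * cexp (η * L.ω₁)) *
          ((L.weierstrassSigma (z - v) / L.weierstrassSigma z) ^ N * cexp (η * z)) := by ring
    _ = (L.weierstrassSigma (z - v) / L.weierstrassSigma z) ^ N * cexp (η * z) := by
        rw [← exp_add, show N * -(L.η₁ * v) + η * L.ω₁ = η * L.ω₁ - N * (L.η₁ * v) by ring, h1, one_mul]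

/-- **`Λ`-periodicity of the `σ`-quotient in `ω₂`** for torsion `v`. [cite: WhittakerWatson1927, §20.53] -/
theorem sigmaQuot_add_ω₂ {v η : ℂ} {N : ℕ} {m n : ℤ} (hNv : (N : ℂ) * v = m * L.ω₁ + n * L.ω₂)
    (hη : η = m * L.η₁ + n * L.η₂) (z : ℂ) : sigmaQuot L v N η (z + L.ω₂) = sigmaQuot L v N η z := by
  unfold sigmaQuot
  rw [sigma_div_add_ω₂, mul_pow, ← exp_nat_mul, mul_add, exp_add]
  have h2 := (exp_legendre_multiplier L hNv hη).2
  calc cexp (N * -(L.η₂ * v)) * (L.weierstrassSigma (z - v) / L.weierstrassSigma z) ^ N * (cexp (η * z) * cexp (η * L.ω₂))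
      = (cexp (N * -(L.η₂ * v)) * cexp (η * L.ω₂)) *
          ((L.weierstrassSigma (z - v) / L.weierstrassSigma z) ^ N * cexp (η * z)) := by ring
    _ = (L.weierstrassSigma (z - v) / L.weierstrassSigma z) ^ N * cexp (η * z) := by
        rw [← exp_add, show N * -(L.η₂ * v) + η * L.ω₂ = η * L.ω₂ - N * (L.η₂ * v) by ring, h2, one_mul]

/-! ### Local structure at `0` and at `v` -/

/-- **Pole of order `N` at `0`**: `g(z) = F₁(z)/z^N` on `ℂ ∖ {0}` with `F₁(z) = (σ(z − v)/s(z))^N e^{ηz}` analytic at `0` and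
`F₁(0) = σ(−v)^N ≠ 0` (`v ∉ Λ`). [cite: WhittakerWatson1927, §20.53] -/
theorem sigmaQuot_eq_div_pow_near_zero {v : ℂ} (hv : v ∉ L.lattice) (N : ℕ) (η : ℂ) :
    ∃ F₁ : ℂ → ℂ, AnalyticAt ℂ F₁ 0 ∧ F₁ 0 ≠ 0 ∧ ∀ z : ℂ, z ≠ 0 → sigmaQuot L v N η z = F₁ z / z ^ N := by
  refine ⟨fun z => (L.weierstrassSigma (z - v) / sigmaCofactor L z) ^ N * cexp (η * z), ?_, ?_, fun z hz => ?_⟩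
  · have hσ : AnalyticAt ℂ (fun z => L.weierstrassSigma (z - v)) 0 :=
      (L.differentiable_weierstrassSigma_holds.comp (differentiable_id.sub_const v)).analyticAt 0
    have hs : AnalyticAt ℂ (sigmaCofactor L) 0 := analyticAt_sigmaCofactor L 0
    have hs0 : sigmaCofactor L 0 ≠ 0 := by rw [sigmaCofactor_zero]; exact one_ne_zero
    exact ((hσ.div hs hs0).pow N).mul ((analyticAt_const.mul analyticAt_id).cexp)
  · have hv' : -v ∉ L.lattice := fun h => hv (by simpa using L.lattice.neg_mem h)
    simp only [zero_sub, sigmaCofactor_zero, div_one, mul_zero, exp_zero, mul_one]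
    exact pow_ne_zero _ (L.weierstrassSigma_ne_zero hv')
  · simp only [sigmaQuot, weierstrassSigma_eq_mul_sigmaCofactor L z]
    rw [show L.weierstrassSigma (z - v) / (z * sigmaCofactor L z) =
      (L.weierstrassSigma (z - v) / sigmaCofactor L z) / z by rw [div_div, mul_comm]]
    rw [div_pow]
    ring

/-- **Zero of order `N` at `v`**: `g(z) = (z − v)^N · u(z)` with `u(z) = (s(z − v)/σ(z))^N e^{ηz}` analytic at `v` and
`u(v) = e^{ηv}/σ(v)^N ≠ 0` (`v ∉ Λ`). [cite: WhittakerWatson1927, §20.53] -/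
theorem sigmaQuot_eq_pow_mul {v : ℂ} (hv : v ∉ L.lattice) (N : ℕ) (η : ℂ) :
    ∃ u : ℂ → ℂ, AnalyticAt ℂ u v ∧ u v ≠ 0 ∧ ∀ z : ℂ, sigmaQuot L v N η z = (z - v) ^ N * u z := by
  refine ⟨fun z => (sigmaCofactor L (z - v) / L.weierstrassSigma z) ^ N * cexp (η * z), ?_, ?_, fun z => ?_⟩
  · have hs : AnalyticAt ℂ (fun z => sigmaCofactor L (z - v)) v :=
      ((differentiable_sigmaCofactor L).comp (differentiable_id.sub_const v)).analyticAt v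
    have hσ : AnalyticAt ℂ L.weierstrassSigma v := analyticAt_weierstrassSigma L v
    exact ((hs.div hσ (L.weierstrassSigma_ne_zero hv)).pow N).mul ((analyticAt_const.mul analyticAt_id).cexp)
  · simp only [sub_self, sigmaCofactor_zero, one_div]
    exact mul_ne_zero (pow_ne_zero _ (inv_ne_zero (L.weierstrassSigma_ne_zero hv))) (exp_ne_zero _)
  · simp only [sigmaQuot, weierstrassSigma_eq_mul_sigmaCofactor L (z - v)]
    rw [mul_div_assoc, mul_pow]
    ring

/-! ### The logarithmic derivative -/

/-- `σ′(w) = ζ(w) σ(w)` off `Λ`. [cite: WhittakerWatson1927, §20.42] -/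
theorem hasDerivAt_weierstrassSigma_eq_zeta_mul {w : ℂ} (hw : w ∉ L.lattice) :
    HasDerivAt L.weierstrassSigma (L.weierstrassZeta w * L.weierstrassSigma w) w := by
  have hd : HasDerivAt L.weierstrassSigma (deriv L.weierstrassSigma w) w :=
    (L.differentiable_weierstrassSigma_holds w).hasDerivAt
  have hlog := L.logDeriv_weierstrassSigma_holds w hw
  rw [logDeriv_apply] at hlog
  have hσ := L.weierstrassSigma_ne_zero hw
  have e : deriv L.weierstrassSigma w = L.weierstrassZeta w * L.weierstrassSigma w := by
    rw [← hlog]; field_simp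
  rwa [e] at hd

/-- **`g′ = g · (N (ζ(z − v) − ζ(z)) + η)`** for `z ∉ Λ`, `z − v ∉ Λ`. [cite: WhittakerWatson1927, §20.53] -/
theorem hasDerivAt_sigmaQuot (v : ℂ) (N : ℕ) (η : ℂ) {z : ℂ} (hz : z ∉ L.lattice) (hzv : z - v ∉ L.lattice) :
    HasDerivAt (sigmaQuot L v N η)
      (sigmaQuot L v N η z * (N * (L.weierstrassZeta (z - v) - L.weierstrassZeta z) + η)) z := by
  have hσz := L.weierstrassSigma_ne_zero hz
  have hσzv := L.weierstrassSigma_ne_zero hzv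
  -- the quotient `q = σ(· − v)/σ`
  have hnum : HasDerivAt (fun w => L.weierstrassSigma (w - v))
      (L.weierstrassZeta (z - v) * L.weierstrassSigma (z - v)) z :=
    (hasDerivAt_weierstrassSigma_eq_zeta_mul L hzv).comp_sub_const z v
  have hden := hasDerivAt_weierstrassSigma_eq_zeta_mul L hz
  have hq := hnum.div hden hσz
  have hexp : HasDerivAt (fun w => cexp (η * w)) (cexp (η * z) * η) z := by
    have h := ((hasDerivAt_id z).const_mul η).cexp
    simpa using h
  cases N with
  | zero =>
    have e : sigmaQuot L v 0 η = fun w => cexp (η * w) := by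
      funext w; simp [sigmaQuot]
    rw [e]
    convert hexp using 1
    simp
  | succ k =>
    have hqN := hq.pow (k + 1)
    have hall := hqN.mul hexp
    have efun : sigmaQuot L v (k + 1) η =
        ((fun w => L.weierstrassSigma (w - v)) / L.weierstrassSigma) ^ (k + 1) * fun w => cexp (η * w) := by
      funext w
      simp [sigmaQuot, Pi.div_apply, Pi.pow_apply, Pi.mul_apply]
    rw [efun]
    refine hall.congr_deriv ?_
    simp only [Pi.div_apply, Pi.pow_apply, Pi.mul_apply, Nat.add_sub_cancel, Nat.cast_add, Nat.cast_one, pow_succ]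
    field_simp

end TorsionLayer


end Summit.KontsevichZagierPeriods.SymplecticScissors.RealOnePeriodRelations

end
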